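import Summits.Ventures.PercRepro.S2FourteenNineCfG
import Summits.Ventures.PercRepro.S2FourteenNineK1
import Summits.Ventures.PercRepro.S2FourteenNineK2
import Summits.Ventures.PercRepro.S2ColoopSharp

/-!
# PercRepro — S2: THE CELL `(14, 9)` OF THE `q = 5` WINDOW (p7, gen 13; sub-claim S2; the `p = 14` row)

The double coloop split of `(14, 12)`: a coloop `e` is split off (`delete_core_data`), a second one `f` too; the scaled cells
`c025_thirteen_nine_cfk1` ((13, 9) coloop-free at `K₁ = 13034`, `(Φ(14,5) − 2)/2`) and `c025_twelve_nine_k2` ((12, 9) on the standard caps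
at `K₂ = 14474`, `(Φ − 6)/4`) are lifted by the sharpened coloop steps; without coloops `c025_fourteen_nine_cfg` (the graded partition count
in the case `ν = 6`). **`ThmN.c025_core_five_fourteen_nine (M) [M.Finite] (hR : ρ(E) = 14) (hn : |E| = 23) (hfree) : RLS M 14 5`**.
Axioms: standard.
-/

open scoped Matroid

namespace PercRepro

namespace ThmN

variable {α : Type}

/-- **THE CELL `(14, 9)`**: by the double coloop split. -/
theorem c025_core_five_fourteen_nine (M : Matroid α) [M.Finite]
    (hR : M.eRank = ((14 : ℕ) : ℕ∞)) (hn : M.E.ncard = 14 + 9)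
    (hfree : ∀ e ∈ M.E, ∃ A ⊆ M.E \ {e}, e ∉ M.closure A ∧ e ∉ M.closure ((M.E \ {e}) \ A)) : RLS M 14 5 := by
  classical
  by_cases hK : ∃ e, M.IsColoop e
  · obtain ⟨e, he⟩ := hK
    obtain ⟨hn', hR', hfree', -⟩ := delete_core_data M he (p := 13) (d := 9) (by rw [hR]) hn hfree
    rw [RLS_iff]
    by_cases hK' : ∃ f, (M ＼ {e}).IsColoop f
    · obtain ⟨f, hf⟩ := hK'
      obtain ⟨hn'', hR'', hfree'', -⟩ := delete_core_data (M ＼ {e}) hf (p := 12) (d := 9) (by rw [hR']) hn' hfree'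
      have key := c025_twelve_nine_k2 ((M ＼ {e}) ＼ {f}) hR'' hn'' hfree''
      exact weighted_of_isColoop_scaled_sharp_iter M he hf (by norm_num : 4 + 1 < 12) (by rw [hR]) (phiK 14 5) key
    · push Not at hK'
      have key := c025_thirteen_nine_cfk1 (M ＼ {e}) hR' hn' hfree' hK'
      exact weighted_of_isColoop_scaled_sharp M he (by norm_num : 4 + 1 < 13) (by rw [hR]) (phiK 14 5) key
  · push Not at hK
    exact c025_fourteen_nine_cfg M hR hn hfree hK

end ThmN

end PercRepro
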